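import Summits.BirchSwinnertonDyer.BirchSwinnertonDyer.Theorems.ClassRecordThreeEulerHalvesAtThreeJetchevMax
import Summits.BirchSwinnertonDyer.BirchSwinnertonDyer.Theorems.ClassRecordThreeEulerHalvesAtThreeWalkSupplyAtThreeDisplayPrint
import HarnessLib

/-!
# Crux 19109 `EulerHalvesAtThree` ON MONO-CARRIER CURVES, BY NAME, MODULO NAMED LITERATURE FACTS ONLY
# (+ TL₃ for the ¬(ram) clause) — the by-name certificate of what the `birth` line has reached (cell
# `bsd-stepL`, seat `bsd-stepL-tam3-p1` g8, helper toward item 19109)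

HONEST FRAMING. Nothing here proves BSD, J₃, TL₃ or the `3`-part of the BSD formula of any curve; every
theorem below is CONDITIONAL on named print (D-0014): the route's `PublishedInputsThree` (item 19112, the
twenty published facts, BY NAME) and five cite-only Literature facts — `h52` McCallum 1991 Prop. 5.2,
`h44` McCallum Prop. 4.4, `hMcU` McCallum Cor. 5.6 ∕ Thm. 5.8 (consumer shape), `hPT` Poitou–Tate duality
for Selmer structures, `hF1` Gross 1991 §6 ∕ [GZ86 III (3.1)] (`y_n − t ∈ E₀`) — and, for the third clause
only, the OPEN input TL₃ (the rank-0 `3`-part lower bound at a multiplicative `3` WITHOUT (ram)). No item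
closes; 0 classes move (T7); `--supports stmt-BirchSwinnertonDyer-19109` (helper).

WHAT THIS FILE DOES. A curve `W` with `ClassX11b W 3` is MONO-CARRIER when ONE finite place `v` carries
the whole `3`-part of `∏_ℓ c_ℓ(E)` (`ord₃ ∏c ≤ ord₃ c_v`; all carrier kinds: (α) `v = 3` split with
`3 ∣ ord₃ Δ`, (β) a split multiplicative `ℓ ≠ 3`, (γ) an additive IV ∕ IV* place). On such curves the
registered Euler-system input of the line, `stub_jetchevMaxHLAtThree` (Jetchev 2008 Thm. 1.4 in MAX form at
`3 ∥ N`), is the FULL-depth divisibility, and it is now a tree theorem modulo six named Literature facts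
(`Koly.jetchevMaxHLAtThree_of_facts_of_print`, this seat g8). Composing with `…JetchevMax` §2 (p438720):
* `missingUpperBoundAt_three_of_classX11b_of_ram_of_monoCarrier_of_print` — clauses (α) and (γ∖α) of the
  crux (indeed `Typed.MissingUpperBoundAt W 3` for every (ram) mono-carrier X11b@3 curve) ⟸ NAMED PRINT
  ONLY (the (ram) twist is handled by Skinner 2016 Thm. C, a conjunct of `PublishedInputsThree`);
* `missingUpperBoundAt_three_of_classX11b_of_surj_of_monoCarrier_of_print_of_twistLower` — the ¬(ram) ∧
  surj clause on mono-carrier curves ⟸ named print + TL₃;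
* `eulerHalvesAtThree_monoCarrier_of_print_of_twistLower` — the crux's three clauses VERBATIM under the
  extra hypothesis «mono-carrier» ⟸ named print + TL₃: the statement a split child «EulerHalvesAtThree on
  mono-carrier curves» would carry, with its exact trust base.
What remains OPEN of item 19109 after this: the MULTI-carrier curves (`∀ v, ord₃ c_v < ord₃ ∏c`; Jetchev's
Conj. 1.3 — every printed Kolyvagin-system method gives only the maximum, Jetchev Cor. 1.5, Büyükboduk
2008 Q1–Q2; census pointer, evidence only: 407 of the 567 TRUE-OPEN (T2′)@3 classes) and TL₃ on the
¬(ram) locus (no printed rank-0 lower bound at `p = 3` without (ram)).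
References (locators only; no cited FACT is declared): [cite: Jetchev2008, Thm. 1.4, Cor. 1.5, Conj. 1.3
(p. 812)] [cite: McCallumLMS1991, §4 Prop. 4.4, §5 Prop. 5.2, Cor. 5.6] [cite: GrossLMS1991, §6 Prop. 6.2
(1)] [cite: GrossZagier1986, I (6.3), III (3.1)] [cite: Skinner2016PacificMC, Thm. C (§1)]
[cite: MilneADT2006, Ch. I, Thm. 4.10(b)] [cite: Buyukboduk2008, Questions 1–2]. Design: three theorems,
no definitions. Axioms: `propext`, `Classical.choice`, `Quot.sound`.
-/

set_option autoImplicit false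

noncomputable section

open scoped Classical NumberField

namespace Summit.BirchSwinnertonDyer.Rank1Residual.X11b.Three.Koly

open WeierstrassCurve IsDedekindDomain NumberField Field Literature.NumberTheory.EllipticCurves
  Literature.NumberTheory.EllipticCurves.ModularForms Literature.NumberTheory.EllipticCurves.Jetchev2008
  Literature.NumberTheory.EllipticCurves.KolyvaginCocycle
  Literature.NumberTheory.EllipticCurves.Rank1Residual Literature.NumberTheory.GaloisRepresentations
  Literature.NumberTheory.GaloisRepresentations.DiscreteGaloisModule
  Literature.NumberTheory.GaloisCohomology Literature.NumberTheory.Automorphic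
  Summit.BirchSwinnertonDyer.Rank1Residual Summit.BirchSwinnertonDyer.Rank1Residual.X11b
  Summit.BirchSwinnertonDyer.Rank1Residual.JET

/-- **(ram) ∧ MONO-CARRIER X11b@3 curves: the Euler-system half `Typed.MissingUpperBoundAt W 3` MODULO
NAMED PRINT ONLY** — `PublishedInputsThree` (by name) + McCallum Prop. 5.2 ∕ Prop. 4.4 ∕ Cor. 5.6 +
Poitou–Tate + Gross 1991 §6 ∕ [GZ86 III (3.1)]. Covers clauses (α) and (γ∖α)-split of crux 19109 on
mono-carrier curves. CONDITIONAL; nothing booked. [cite: Jetchev2008, Thm. 1.4 and Cor. 1.5 (p. 812)]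
[cite: McCallumLMS1991, §5 Prop. 5.2, Cor. 5.6] [cite: Skinner2016PacificMC, Thm. C (§1)] -/
theorem missingUpperBoundAt_three_of_classX11b_of_ram_of_monoCarrier_of_print
    (h : Summit.BirchSwinnertonDyer.BirchSwinnertonDyer.Theses.ClassRecordThree.PublishedInputsThree)
    (h52 : McCallum1991.prop52_exists_conductor_kolyvaginClass_order_eq)
    (h44 : McCallum1991.prop44_localOrder_kolyvaginClass_mul_eq)
    (hMcU : McCallum1991_padicValNat_card_sha_primary_add_le_of_globalDivisibility)
    (hPT : ∀ (K : Type) [Field K] [NumberField K], poitouTate_selmerStructure_duality_conj K)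
    (hF1 : Gross1991_heegnerPoint_sub_ratTorsion_mem_E0)
    (W : WeierstrassCurve ℚ) [W.IsElliptic] [W.IsGloballyMinimal]
    (hX : ClassX11b W 3) (hram : Ram W 3)
    (hmono : ∃ v : HeightOneSpectrum (𝓞 ℚ),
      padicValNat 3 W.tamagawaProduct ≤ padicValNat 3 (W.tamagawaNumberAt v)) :
    Typed.MissingUpperBoundAt W 3 := by
  obtain ⟨hGZ, hKo, -, hSk, -, hGZK, hmod, hnf, hHL, hMaz, -, -, -, -, -, -, -, -, -, -⟩ := h
  exact missingUpperBoundAt_three_of_classX11b_of_ram_of_monoCarrier_of_jetchevMaxHL hGZ hKo hSk hGZK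
    hmod hnf hHL hMaz (fun N _ W K _ _ ↦ heegnerPointOfConductor_one_galoisConj_holds N W K)
    (fun N _ W K _ _ ↦ phi_heegnerTau_mem_singularModuliField_holds N W K) hMcU
    (jetchevMaxHLAtThree_of_facts_of_print h52 h44 hGZ hmod hPT hF1) W hX hram hmono

/-- **surj ∧ MONO-CARRIER X11b@3 curves, NO (ram): `Typed.MissingUpperBoundAt W 3` MODULO NAMED PRINT
+ TL₃** (the twist descent without (ram) is the open input). Covers the ¬(ram) ∧ surj clause of crux
19109 on mono-carrier curves. CONDITIONAL; nothing booked. [cite: Jetchev2008, Thm. 1.4 and Cor. 1.5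
(p. 812)] [cite: McCallumLMS1991, §5 Prop. 5.2, Cor. 5.6] [cite: Skinner2016PacificMC, Thm. C (§1) —
shape of TL₃ only] -/
theorem missingUpperBoundAt_three_of_classX11b_of_surj_of_monoCarrier_of_print_of_twistLower
    (h : Summit.BirchSwinnertonDyer.BirchSwinnertonDyer.Theses.ClassRecordThree.PublishedInputsThree)
    (h52 : McCallum1991.prop52_exists_conductor_kolyvaginClass_order_eq)
    (h44 : McCallum1991.prop44_localOrder_kolyvaginClass_mul_eq)
    (hMcU : McCallum1991_padicValNat_card_sha_primary_add_le_of_globalDivisibility)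
    (hPT : ∀ (K : Type) [Field K] [NumberField K], poitouTate_selmerStructure_duality_conj K)
    (hF1 : Gross1991_heegnerPoint_sub_ratTorsion_mem_E0)
    (hTL : ∀ (V : WeierstrassCurve ℚ) [V.IsElliptic] [V.IsGloballyMinimal],
      V.HasMultiplicativeReductionAtPrime 3 → V.HasIrreducibleModPGaloisRep 3 →
      V.entireLFunction 1 ≠ 0 → Finite V.sha →
      ∃ q : ℚ, V.entireLFunction 1 / (V.realPeriodRat : ℂ) = (q : ℂ) ∧
        padicValRat 3 q ≤ (padicValNat 3 V.shaOrder : ℤ) + padicValNat 3 V.tamagawaProduct -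
          2 * padicValNat 3 V.torsionOrder)
    (W : WeierstrassCurve ℚ) [W.IsElliptic] [W.IsGloballyMinimal]
    (hX : ClassX11b W 3) (hρ : Surj W 3)
    (hmono : ∃ v : HeightOneSpectrum (𝓞 ℚ),
      padicValNat 3 W.tamagawaProduct ≤ padicValNat 3 (W.tamagawaNumberAt v)) :
    Typed.MissingUpperBoundAt W 3 := by
  obtain ⟨hGZ, hKo, -, -, -, hGZK, hmod, hnf, hHL, hMaz, -, -, -, -, -, -, -, -, -, -⟩ := h
  exact missingUpperBoundAt_three_of_classX11b_of_surj_of_monoCarrier_of_jetchevMaxHL_of_twistLower hGZ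
    hKo hGZK hmod hnf hHL hMaz (fun N _ W K _ _ ↦ heegnerPointOfConductor_one_galoisConj_holds N W K)
    (fun N _ W K _ _ ↦ phi_heegnerTau_mem_singularModuliField_holds N W K) hMcU
    (jetchevMaxHLAtThree_of_facts_of_print h52 h44 hGZ hmod hPT hF1) hTL W hX hρ hmono

/-- **Crux 19109's three clauses VERBATIM on MONO-CARRIER curves ⟸ named print + TL₃** — the statement a
split child «`EulerHalvesAtThree` on mono-carrier curves» would carry, with its exact trust base:
`PublishedInputsThree` (by name), five cite-only Literature facts, and TL₃ (used by the third clause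
only). CONDITIONAL; nothing booked. [cite: Jetchev2008, Thm. 1.4 and Cor. 1.5 (p. 812)]
[cite: McCallumLMS1991, §5 Prop. 5.2, Cor. 5.6] [cite: Skinner2016PacificMC, Thm. C (§1)] -/
theorem eulerHalvesAtThree_monoCarrier_of_print_of_twistLower
    (h : Summit.BirchSwinnertonDyer.BirchSwinnertonDyer.Theses.ClassRecordThree.PublishedInputsThree)
    (h52 : McCallum1991.prop52_exists_conductor_kolyvaginClass_order_eq)
    (h44 : McCallum1991.prop44_localOrder_kolyvaginClass_mul_eq)
    (hMcU : McCallum1991_padicValNat_card_sha_primary_add_le_of_globalDivisibility)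
    (hPT : ∀ (K : Type) [Field K] [NumberField K], poitouTate_selmerStructure_duality_conj K)
    (hF1 : Gross1991_heegnerPoint_sub_ratTorsion_mem_E0)
    (hTL : ∀ (V : WeierstrassCurve ℚ) [V.IsElliptic] [V.IsGloballyMinimal],
      V.HasMultiplicativeReductionAtPrime 3 → V.HasIrreducibleModPGaloisRep 3 →
      V.entireLFunction 1 ≠ 0 → Finite V.sha →
      ∃ q : ℚ, V.entireLFunction 1 / (V.realPeriodRat : ℂ) = (q : ℂ) ∧
        padicValRat 3 q ≤ (padicValNat 3 V.shaOrder : ℤ) + padicValNat 3 V.tamagawaProduct -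
          2 * padicValNat 3 V.torsionOrder) :
    ∀ (W : WeierstrassCurve ℚ) [W.IsElliptic] [W.IsGloballyMinimal], ClassX11b W 3 →
      (∃ v : HeightOneSpectrum (𝓞 ℚ),
        padicValNat 3 W.tamagawaProduct ≤ padicValNat 3 (W.tamagawaNumberAt v)) →
      (Ram W 3 → ShapeAlpha W → Typed.MissingUpperBoundAt W 3) ∧
      (Ram W 3 → W.HasSplitMultiplicativeReductionAtPrime 3 → ¬ ShapeAlpha W → ShapeGamma W →
        Typed.MissingUpperBoundAt W 3) ∧
      (Surj W 3 → ¬ Ram W 3 → Typed.MissingUpperBoundAt W 3) := by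
  obtain ⟨hGZ, hKo, -, hSk, -, hGZK, hmod, hnf, hHL, hMaz, -, -, -, -, -, -, -, -, -, -⟩ := h
  exact eulerHalvesAtThree_monoCarrier_of_jetchevMaxHL_of_twistLower hGZ hKo hSk hGZK hmod hnf hHL hMaz
    (fun N _ W K _ _ ↦ heegnerPointOfConductor_one_galoisConj_holds N W K)
    (fun N _ W K _ _ ↦ phi_heegnerTau_mem_singularModuliField_holds N W K) hMcU
    (jetchevMaxHLAtThree_of_facts_of_print h52 h44 hGZ hmod hPT hF1) hTL

end Summit.BirchSwinnertonDyer.Rank1Residual.X11b.Three.Koly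

end
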